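import Summits.QuantumFields.YangMills.Theorems.BalabanUVNodesN15KingModelFullPropagatorOperatorEntries
import Summits.QuantumFields.YangMills.Theorems.BalabanUVNodesN15KingModelFullPropagatorLaplacian
import Summits.QuantumFields.YangMills.Theorems.BalabanUVNodesN15KingModelRungUnit

/-!
# BalabanUVNodes ∕ N15 — THE KING-MODEL RUNG, CURVED EDITION (PART Q5): NE2⁰'s OPERATOR LAYER ((3.42), all four sup entries) DECIDED FOR
# KING'S ∕ BAŁABAN'S FULL `A = 0` FLUCTUATION PROPAGATOR `A₀⁻¹ = G_k(T_ε, 0)` WITH GENUINE η-LATTICE TEST FUNCTIONS —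
# `T4EtaRate.NE2ZeroOperator` (and `NE2PlusOperator` on the one-point background sort) for the carrier whose arguments `λ` live on `T_η`
# (Track A, DAG node N15 = NE2; FAN-OUT v1.1 §N15 s3 «KING-MODEL RUNG: NE2's analogue DECIDED in the model + what the curved case adds»)

HONEST FRAMING.  Count-neutral kernel bookkeeping (cell `pub-ymgap`, seat `pub-ymgap-dag-n15-e` g7; `--supports stmt-QuantumFields-20292 --as helper`
= K3⁗ `SpineGivenEndpointR13Sep`).  TEMPLATE LITERATURE, `A = 0`: C. King's scalar U(1)-Higgs MODEL on finite tori ([King1986]); the propagator is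
King's `G_k(T_ε, 0)` = [Ba 4]'s `G_k(Ω, A)` of (1.6) at `A = 0`, `Ω = T` (no large-field regions: every site of `𝔅` is a unit block), i.e. Bałaban's
own `G(U)` of [B9] Thm 3.1 at `U ≡ 1` in the collapsed single-scale geometry, with a mass `0 < m² ≤ m₀²`.  What is DECIDED: the HYPOTHESIS SHAPE
`T4EtaRate.NE2ZeroOperator` (the four (3.42) sup entries of the η-DIFFERENCE family with King's rate factor) HOLDS for this family — a theorem
about SHAPES the cell typed, assembled from the (2.17)-summed estimates of parts P″ ∕ Q4a ∕ Q4b; NOT a printed proposition of King or Bałaban;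
NE2⁺ for Bałaban's `G_k(U)` on a LIVE background sort is NOT PRINTED and NOT proved; NOT a node discharge; nothing continuum ∕ ℝ⁴ ∕ OS ∕ mass-gap ∕
Clay.  0 `sorry`; plumbing `def`s (a `B9.Geometry` carrier, its pairing ∕ instance ∕ kernel family, the index record); standard axioms.

CONTENT.  §1 `etaLatGeo d L Msz k N M` — [B9]'s abstract `Geometry` REALISED for the no-large-field torus: sites = unit blocks `Tor M` (scale `k`,
`L^kη = 1`), `dist = tdistT M`, `η = L^{−k}`, cube-size parameter `Msz` inert; ARGUMENTS `Loc := Tor (fine N M) → ℝ` = functions `λ` ON THE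
η-LATTICE, `suppIn λ y′ = supp λ ⊂ Δ(y′) = B^k(y′)` (p. 397), `suppInT` = within block distance `≤ 1`, `supNorm λ = max|λ|`; Hölder ∕ L² ∕ weighted
sizes and cut-offs inert (the (3.42) sup entries do not read them) — g6 HANDOFF door (t2⁶) (g0's `torusOpGeo` has unit-torus test functions
only); `etaLatPairing` — scale shift `n`, `ι = id` on unit blocks, `τλ = λ∘π` (King p. 664, `underPtN`).  §2 `EtaLatIdx` (`e, K ≥ 1, n ≥ 1,
0 < m² ≤ m₀², Msz`), `etaLatInstance` (coarse `N = L^K`, fine `N′ = L^nL^K`, one-point backgrounds `pt9Bg`), `etaLatKF` — the η-difference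
OPERATOR family whose four (3.42) entries at `(λ, y)` are the sups over the fine points `x′` of the unit block `y` of
`|(A₀′⁻¹τλ)(x′) − (A₀⁻¹λ)(x)|`, `Σ_μ|∂^{η′}_μ(A₀′⁻¹τλ)(x′) − (∂^η_μA₀⁻¹λ)(x)|`, `Σ_μ|(A₀′⁻¹∇′*_μτλ)(x′) − (A₀⁻¹∇*_μλ)(x)|`, `|(Δ^{η′}A₀′⁻¹τλ)(x′) − (Δ^ηA₀⁻¹λ)(x)|`
(`x = πx′`; `A₀ = fineOp (L^K) M a_K (L^K)² m²`, King (4.1)–(4.5) = [Ba 4] (1.6) at `A = 0`).  §3 `etaRateIneq342_fullProp` — ONE constant block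
`(B₀, δ, γ = 1∕4)` for the whole family (parts' printed shapes read at `D = ⌊|y − y′|_M⌋`; `len = 1`, `rateFactor = (L^{−γ})^K`);
★★★ **`ne2ZeroOperator_fullProp : NE2ZeroOperator (etaLatInstance …) (etaLatKF …)`**; `ne2PlusOperator_fullProp` (via g0's
`ne2PlusOperator_iff_ne2ZeroOperator`).
WHAT THE CURVED CASE ADDS (one line): the SAME four inequalities for Bałaban's `G_k(U)`, `∇_UG_k(U)`, `G_k(U)∇*_U`, `Δ_UG_k(U)` on the multiscale
`𝔅 = ⋃Λ_j` with `(L^jη)`-prefactors, UNIFORMLY over the live window `∀ U, Reg335 c35 α₀ U` — print gives analyticity in `U` ([B9] Thm 3.4) and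
η-uniformity, never an η-difference (cell GAPS G-t4-U1a-1).
HONEST SCOPE.  (i) `A = 0`, periodic b.c., odd `L ≥ 3`, `a > 0`, `0 < m² ≤ m₀²`, cubes `2L^e`, `K, n ≥ 1`; (ii) single-scale geometry (no `Λ_j`,
`j < k`); (iii) rate exponent `γ = 1∕4` (any `γ < 1∕2` would do); (iv) one-point backgrounds; (v) `x = πx′`; not Bałaban's live `G_k(U)`; not a discharge.
Locators: [King1986] C. King, CMP **102** (1986) 649–677: (2.13)–(2.17) p. 653, (4.1)–(4.5) p. 670, Theorem 3.3 (3.7) p. 658, Prop. 3.8 (3.71)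
p. 664, p. 664 (pairing), Prop. 3.9 (3.73) p. 665 (rate factor); [Ba 4] = [Balaban1983RegularityDecay] (1.6) p. 572, Theorem (1.10) p. 573; [B9] =
[Balaban1985BackgroundPropagators] Sect. A (3.35)–(3.41) pp. 396–397, Thm 3.1 (3.42) p. 397, Thm 3.4 p. 400, Thm 3.14 pp. 426–427 (template).
-/

noncomputable section

namespace Summit.QuantumFields.YangMills.BalabanUVNodes.N15KingModelRung.Curved

open Real Finset Matrix
open Literature.MathematicalPhysics.QuantumFieldTheory.Balaban1983to89
open Literature.MathematicalPhysics.QuantumFieldTheory.Balaban1983to89.T4EtaRate (EtaPairing PairedInstance EtaRateIneq342 NE2ZeroOperator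
  NE2PlusOperator rateFactor rateFactor_unit eta_rpow_eq_theta_pow)
open Literature.MathematicalPhysics.QuantumFieldTheory.Balaban1983to89.T4EtaRateOperatorTorus (pref4_one)
open Literature.MathematicalPhysics.QuantumFieldTheory.Balaban1983to89.T4EtaRateDefectSite (pt9Bg)
open Literature.MathematicalPhysics.QuantumFieldTheory.Balaban1983to89.B5Prop11Plancherel (Tor fine unitVec)
open Literature.MathematicalPhysics.QuantumFieldTheory.King1986 (aK aK_pos)
open Literature.MathematicalPhysics.QuantumFieldTheory.King1986.Torus (fineOp blockOf tdistT tdistT_nonneg tdistT_self)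

variable {d : ℕ}

/-! ## §1 The carrier with η-lattice test functions, and King's pairing -/

/-- **[B9]'s GEOMETRY REALISED WITH η-LATTICE TEST FUNCTIONS** (no-large-field torus, single scale): sites = unit blocks `Tor M` (all of scale
index `k`, `η = L^{−k}`, `L^kη = 1`), `dist` = King's block distance, cube-size parameter `Msz` (inert); arguments `λ : Tor (fine N M) → ℝ` ON THE
η-LATTICE (`N` fine points per block side), `suppIn λ y′ = supp λ ⊂ B^k(y′)`, `suppInT λ y′ = supp λ` within block distance `≤ 1` of `y′`,
`supNorm λ = max|λ|`; Hölder ∕ L² ∕ weighted sizes and the cut-off sort inert.  `reducible`, so that instances are found on `Site`∕`Loc`.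
[cite: Balaban1985BackgroundPropagators, Sect. A (3.39)–(3.41) pp.396–397 (carrier), p.397 («Δ(y) = B^j(y)»), (3.42) p.397 (shape)] -/
@[reducible] def etaLatGeo (d : ℕ) (L Msz : ℝ) (k : ℕ) (N : ℕ) [NeZero N] (M : Fin (d + 1) → ℕ) [∀ μ, NeZero (M μ)] : B9.Geometry where
  Site := Tor M
  scale := fun _ => k
  dist := fun y y' => tdistT M y y'
  k := k
  eta := (L ^ k)⁻¹
  L := L
  M := Msz
  Loc := Tor (fine N M) → ℝ
  suppIn := fun lam y' => ∀ z, lam z ≠ 0 → blockOf N M z = y'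
  suppInT := fun lam y' => ∀ z, lam z ≠ 0 → tdistT M (blockOf N M z) y' ≤ 1
  supNorm := fun lam => Finset.univ.sup' Finset.univ_nonempty fun z => |lam z|
  l2Norm := fun _ => 0
  wNorm := fun _ _ => 0
  holder := fun _ _ => 0
  Cut := Unit
  cutIn := fun _ _ => True
  cutInT := fun _ _ => True
  cutH := fun _ _ => 0
  cutSup := fun _ => 0
  suppInT_of_suppIn := fun lam y' h z hz => by
    rw [h z hz, tdistT_self]
    exact zero_le_one
  cutInT_of_cutIn := fun _ _ h => h

/-- Every site has physical size `L^kη = 1` (`L ≠ 0`). [folklore] -/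
theorem etaLatGeo_len (L Msz : ℝ) (k N : ℕ) [NeZero N] (M : Fin (d + 1) → ℕ) [∀ μ, NeZero (M μ)] (hL : L ≠ 0)
    (y : (etaLatGeo d L Msz k N M).Site) : (etaLatGeo d L Msz k N M).len y = 1 := by
  show L ^ k * (L ^ k)⁻¹ = 1
  exact mul_inv_cancel₀ (pow_ne_zero _ hL)

/-- King's rate factor on the carrier is the clean geometric rate `(η∕L^kη)^γ = (L^{−γ})^k`. [cite: King1986, Prop. 3.9 (3.73) p.665 (rate factor)] -/
theorem rateFactor_etaLatGeo (L Msz : ℝ) (k N : ℕ) [NeZero N] (M : Fin (d + 1) → ℕ) [∀ μ, NeZero (M μ)] (hL : 0 < L) (γ : ℝ)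
    (y : (etaLatGeo d L Msz k N M).Site) : rateFactor (etaLatGeo d L Msz k N M) γ y = (L ^ (-γ)) ^ k := by
  rw [rateFactor_unit γ (etaLatGeo_len L Msz k N M hL.ne' y)]
  exact eta_rpow_eq_theta_pow (g := etaLatGeo d L Msz k N M) rfl hL γ

/-- **KING'S η-PAIRING BETWEEN THE RUNS `K` AND `K + n` ON THE SAME CUBE**: scale shift `n`; `ι = id` (a unit block of run A IS a unit block of
run B); `τλ = λ∘π` («when x′ ∈ T_{η′}, we denote by x that point in T_η for which x′ ∈ B^n(x)»), support- and sup-norm-compatible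
(`blockOf_underPtN`); backgrounds one-point. [cite: King1986, p.664 (convention before Prop. 3.8)] -/
def etaLatPairing (L : ℕ) [NeZero L] (Msz : ℝ) (K n : ℕ) (M : Fin (d + 1) → ℕ) [∀ μ, NeZero (M μ)] :
    EtaPairing (etaLatGeo d L Msz K (L ^ K) M) (etaLatGeo d L Msz (K + n) (L ^ n * L ^ K) M) pt9Bg pt9Bg where
  n := n
  k_eq := rfl
  L_eq := rfl
  M_eq := rfl
  eta_eq := by
    have hL : ((L : ℕ) : ℝ) ≠ 0 := by exact_mod_cast NeZero.ne L
    show (((L : ℝ)) ^ (K + n))⁻¹ * (L : ℝ) ^ n = ((L : ℝ) ^ K)⁻¹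
    rw [pow_add, mul_inv, mul_assoc, inv_mul_cancel₀ (pow_ne_zero _ hL), mul_one]
  ι := fun y => y
  scale_ι := fun _ => rfl
  dist_ι := fun _ _ => rfl
  τ := fun lam => fun y' => lam (underPtN L K n M y')
  suppIn_τ := fun lam y' h z hz => by
    rw [← blockOf_underPtN]
    exact h _ hz
  supNorm_τ := fun lam =>
    Finset.sup'_le Finset.univ_nonempty _ fun z _ => Finset.le_sup' (fun z => |lam z|) (Finset.mem_univ (underPtN L K n M z))
  avg := fun U => U
  avg_one := rfl

/-! ## §2 The paired-instance family and the η-difference operator family of the full propagator -/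

/-- Index of the family: cube `2L^e`, coarse run `K ≥ 1` levels, scale shift `n ≥ 1`, mass `0 < m² ≤ m₀²`, cube-size parameter `Msz` (inert).
[folklore] -/
structure EtaLatIdx (d : ℕ) (m0sq : ℝ) where
  /-- cube `2L^e` -/
  e : ℕ
  /-- levels of the coarse run -/
  K : ℕ
  one_le_K : 1 ≤ K
  /-- scale shift of the fine run -/
  n : ℕ
  one_le_n : 1 ≤ n
  /-- the mass, in the window `(0, m₀²]` -/
  msq : ℝ
  msq_pos : 0 < msq
  msq_le : msq ≤ m0sq
  /-- [B9]'s cube-size parameter `M ≥ 1` (inert) -/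
  Msz : ℝ
  one_le_Msz : 1 ≤ Msz

/-- The index type is inhabited as soon as the mass window is (`0 < m₀²`; not the empty-index trap). [folklore] -/
theorem etaLatIdx_nonempty (d : ℕ) {m0sq : ℝ} (hm0 : 0 < m0sq) : Nonempty (EtaLatIdx d m0sq) :=
  ⟨⟨0, 1, le_rfl, 1, le_rfl, m0sq, hm0, le_rfl, 1, le_rfl⟩⟩

/-- The cube `M_μ = 2L^e` of the index. [cite: Balaban1987RG1, (0.1) p.251 (volumes 2L^m)] -/
abbrev EtaLatIdx.cube (L : ℕ) {m0sq : ℝ} (i : EtaLatIdx d m0sq) : Fin (d + 1) → ℕ := fun _ => 2 * L ^ i.e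

/-- THE PAIRED-INSTANCE FAMILY: coarse run `K` levels (`N = L^K`), fine run `K + n` levels (`N′ = L^nL^K`) over the cube `2L^e`, one-point
backgrounds, King's pairing. [folklore] -/
def etaLatInstance (d L : ℕ) [NeZero L] (m0sq : ℝ) (i : EtaLatIdx d m0sq) : PairedInstance where
  gc := etaLatGeo d L i.Msz i.K (L ^ i.K) (EtaLatIdx.cube L i)
  gf := etaLatGeo d L i.Msz (i.K + i.n) (L ^ i.n * L ^ i.K) (EtaLatIdx.cube L i)
  Bc := pt9Bg
  Bf := pt9Bg
  pair := etaLatPairing L i.Msz i.K i.n (EtaLatIdx.cube L i)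

section Family

variable (L : ℕ) [NeZero L] (a : ℝ) {m0sq : ℝ} (i : EtaLatIdx d m0sq)

/-- `A₀ = fineOp (L^K) M a_K (L^K)² m²` of the coarse run (King's (4.1)–(4.5) = [Ba 4] (1.6) at `A = 0`), inverted. [cite: King1986, (4.1)–(4.5) p.670; Balaban1983RegularityDecay, (1.6) p.572] -/
abbrev etaLatA : Matrix (Tor (fine (L ^ i.K) (EtaLatIdx.cube L i))) (Tor (fine (L ^ i.K) (EtaLatIdx.cube L i))) ℝ :=
  (fineOp (L ^ i.K) (EtaLatIdx.cube L i) (aK a L i.K) (((L ^ i.K : ℕ) : ℝ) ^ 2) i.msq)⁻¹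

/-- `A₀′⁻¹` of the fine run (`K + n` levels, `N′ = L^nL^K`). [cite: King1986, (4.1)–(4.5) p.670; Balaban1983RegularityDecay, (1.6) p.572] -/
abbrev etaLatA' : Matrix (Tor (fine (L ^ i.n * L ^ i.K) (EtaLatIdx.cube L i))) (Tor (fine (L ^ i.n * L ^ i.K) (EtaLatIdx.cube L i))) ℝ :=
  (fineOp (L ^ i.n * L ^ i.K) (EtaLatIdx.cube L i) (aK a L (i.K + i.n)) (((L ^ i.n * L ^ i.K : ℕ) : ℝ) ^ 2) i.msq)⁻¹

/-- ENTRY 0 of the η-difference family at `(λ, y)`: `sup_{x′ ∈ B(y)} |(A₀′⁻¹τλ)(x′) − (A₀⁻¹λ)(πx′)|`. [cite: Balaban1985BackgroundPropagators, (3.42) p.397 (first entry)] -/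
def etaLatE0 (_U : Unit) (lam : Tor (fine (L ^ i.K) (EtaLatIdx.cube L i)) → ℝ) (y : Tor (EtaLatIdx.cube L i)) : ℝ :=
  Finset.univ.sup' Finset.univ_nonempty fun x' : Tor (fine (L ^ i.n * L ^ i.K) (EtaLatIdx.cube L i)) =>
    if blockOf (L ^ i.n * L ^ i.K) (EtaLatIdx.cube L i) x' = y then
      |(etaLatA' L a i *ᵥ (fun y' => lam (underPtN L i.K i.n (EtaLatIdx.cube L i) y'))) x'
        - (etaLatA L a i *ᵥ lam) (underPtN L i.K i.n (EtaLatIdx.cube L i) x')|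
    else 0

/-- ENTRY 1: `sup_{x′ ∈ B(y)} Σ_μ |∂^{η′}_μ(A₀′⁻¹τλ)(x′) − (∂^η_μA₀⁻¹λ)(πx′)|` (forward η-derivatives, `η′⁻¹ = L^nL^K`, `η⁻¹ = L^K`).
[cite: Balaban1985BackgroundPropagators, (3.42) p.397 (second entry)] -/
def etaLatE1 (_U : Unit) (lam : Tor (fine (L ^ i.K) (EtaLatIdx.cube L i)) → ℝ) (y : Tor (EtaLatIdx.cube L i)) : ℝ :=
  Finset.univ.sup' Finset.univ_nonempty fun x' : Tor (fine (L ^ i.n * L ^ i.K) (EtaLatIdx.cube L i)) =>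
    if blockOf (L ^ i.n * L ^ i.K) (EtaLatIdx.cube L i) x' = y then
      ∑ μ : Fin (d + 1),
        |((L ^ i.n * L ^ i.K : ℕ) : ℝ) *
              ((etaLatA' L a i *ᵥ (fun y' => lam (underPtN L i.K i.n (EtaLatIdx.cube L i) y')))
                  (x' + unitVec (fine (L ^ i.n * L ^ i.K) (EtaLatIdx.cube L i)) μ)
                - (etaLatA' L a i *ᵥ (fun y' => lam (underPtN L i.K i.n (EtaLatIdx.cube L i) y'))) x')
          - ((L ^ i.K : ℕ) : ℝ) *
              ((etaLatA L a i *ᵥ lam) (underPtN L i.K i.n (EtaLatIdx.cube L i) x' + unitVec (fine (L ^ i.K) (EtaLatIdx.cube L i)) μ)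
                - (etaLatA L a i *ᵥ lam) (underPtN L i.K i.n (EtaLatIdx.cube L i) x'))|
    else 0

/-- ENTRY 2: `sup_{x′ ∈ B(y)} Σ_μ |(A₀′⁻¹∇′*_μτλ)(x′) − (A₀⁻¹∇*_μλ)(πx′)|`, `(∇*_μλ)(z) = η⁻¹(λ(z − e_μ) − λ(z))` the adjoint η-derivative.
[cite: Balaban1985BackgroundPropagators, (3.42) p.397 (third entry)] -/
def etaLatE2 (_U : Unit) (lam : Tor (fine (L ^ i.K) (EtaLatIdx.cube L i)) → ℝ) (y : Tor (EtaLatIdx.cube L i)) : ℝ :=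
  Finset.univ.sup' Finset.univ_nonempty fun x' : Tor (fine (L ^ i.n * L ^ i.K) (EtaLatIdx.cube L i)) =>
    if blockOf (L ^ i.n * L ^ i.K) (EtaLatIdx.cube L i) x' = y then
      ∑ μ : Fin (d + 1),
        |(etaLatA' L a i *ᵥ (fun y' => ((L ^ i.n * L ^ i.K : ℕ) : ℝ) *
              (lam (underPtN L i.K i.n (EtaLatIdx.cube L i) (y' - unitVec (fine (L ^ i.n * L ^ i.K) (EtaLatIdx.cube L i)) μ))
                - lam (underPtN L i.K i.n (EtaLatIdx.cube L i) y')))) x'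
          - (etaLatA L a i *ᵥ (fun z => ((L ^ i.K : ℕ) : ℝ) *
              (lam (z - unitVec (fine (L ^ i.K) (EtaLatIdx.cube L i)) μ) - lam z))) (underPtN L i.K i.n (EtaLatIdx.cube L i) x')|
    else 0

/-- ENTRY 3: `sup_{x′ ∈ B(y)} |(Δ^{η′}A₀′⁻¹τλ)(x′) − (Δ^ηA₀⁻¹λ)(πx′)|`, `Δ^ηf(z) = η^{−2}Σ_μ(f(z + e_μ) + f(z − e_μ) − 2f(z))`.
[cite: Balaban1985BackgroundPropagators, (3.42) p.397 (fourth entry)] -/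
def etaLatE3 (_U : Unit) (lam : Tor (fine (L ^ i.K) (EtaLatIdx.cube L i)) → ℝ) (y : Tor (EtaLatIdx.cube L i)) : ℝ :=
  Finset.univ.sup' Finset.univ_nonempty fun x' : Tor (fine (L ^ i.n * L ^ i.K) (EtaLatIdx.cube L i)) =>
    if blockOf (L ^ i.n * L ^ i.K) (EtaLatIdx.cube L i) x' = y then
      |(((L ^ i.n * L ^ i.K : ℕ) : ℝ) ^ 2) *
            ∑ μ, ((etaLatA' L a i *ᵥ (fun y' => lam (underPtN L i.K i.n (EtaLatIdx.cube L i) y')))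
                    (x' + unitVec (fine (L ^ i.n * L ^ i.K) (EtaLatIdx.cube L i)) μ)
                + (etaLatA' L a i *ᵥ (fun y' => lam (underPtN L i.K i.n (EtaLatIdx.cube L i) y')))
                    (x' - unitVec (fine (L ^ i.n * L ^ i.K) (EtaLatIdx.cube L i)) μ)
                - 2 * (etaLatA' L a i *ᵥ (fun y' => lam (underPtN L i.K i.n (EtaLatIdx.cube L i) y'))) x')
        - (((L ^ i.K : ℕ) : ℝ) ^ 2) *
            ∑ μ, ((etaLatA L a i *ᵥ lam) (underPtN L i.K i.n (EtaLatIdx.cube L i) x' + unitVec (fine (L ^ i.K) (EtaLatIdx.cube L i)) μ)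
                + (etaLatA L a i *ᵥ lam) (underPtN L i.K i.n (EtaLatIdx.cube L i) x' - unitVec (fine (L ^ i.K) (EtaLatIdx.cube L i)) μ)
                - 2 * (etaLatA L a i *ᵥ lam) (underPtN L i.K i.n (EtaLatIdx.cube L i) x'))|
    else 0

/-- **THE η-DIFFERENCE OPERATOR FAMILY OF THE FULL `A = 0` PROPAGATOR** as a [B9] `KernelFamily` over the coarse carrier: the four (3.42) sup
entries `etaLatE0 … etaLatE3`; Hölder ∕ L² ∕ global entries inert (not given an η-rate shape by `T4EtaRate`). [cite: Balaban1985BackgroundPropagators, (3.42)–(3.47) pp.397–398 (entries)] -/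
def etaLatKF (d L : ℕ) [NeZero L] (a m0sq : ℝ) (i : EtaLatIdx d m0sq) :
    B9.KernelFamily (etaLatInstance d L m0sq i).gc (etaLatInstance d L m0sq i).Bf where
  e := ![etaLatE0 L a i, etaLatE1 L a i, etaLatE2 L a i, etaLatE3 L a i]
  h1 := fun _ _ _ _ => 0
  e4 := fun _ _ _ => 0
  h2 := fun _ _ _ _ => 0
  l2 := fun _ _ _ _ => 0
  glob := fun _ _ _ _ => 0

end Family

/-! ## §3 The readout: `EtaRateIneq342` with one constant block, `NE2ZeroOperator`, `NE2PlusOperator` -/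

/-- From the parts' currency to the carrier's: with `D = ⌊t⌋` (`t ≥ 0`) and `δ ≤ δ′`, `C·s·e^{−δ′D}·F ≤ C·e^{δ}·e^{−δt}·s·F` (`C, s, F ≥ 0`). [folklore] -/
theorem floor_rate_le {C s F δ δ' t : ℝ} (hC : 0 ≤ C) (hs : 0 ≤ s) (hF : 0 ≤ F) (hδ : 0 ≤ δ) (hδ' : δ ≤ δ') :
    C * s * Real.exp (-(δ' * (⌊t⌋₊ : ℕ))) * F ≤ C * Real.exp δ * Real.exp (-(δ * t)) * s * F := by
  have hD : t - 1 ≤ (⌊t⌋₊ : ℕ) := by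
    have := Nat.lt_floor_add_one t
    linarith
  have hexp : Real.exp (-(δ' * (⌊t⌋₊ : ℕ))) ≤ Real.exp δ * Real.exp (-(δ * t)) := by
    rw [← Real.exp_add]
    apply Real.exp_le_exp.mpr
    have h1 : δ * (⌊t⌋₊ : ℕ) ≤ δ' * (⌊t⌋₊ : ℕ) := mul_le_mul_of_nonneg_right hδ' (Nat.cast_nonneg _)
    nlinarith
  calc C * s * Real.exp (-(δ' * (⌊t⌋₊ : ℕ))) * F ≤ C * s * (Real.exp δ * Real.exp (-(δ * t))) * F :=
        mul_le_mul_of_nonneg_right (mul_le_mul_of_nonneg_left hexp (mul_nonneg hC hs)) hF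
    _ = C * Real.exp δ * Real.exp (-(δ * t)) * s * F := by ring

/-- **`EtaRateIneq342` FOR THE FULL `A = 0` PROPAGATOR, ONE CONSTANT BLOCK FOR THE WHOLE FAMILY**: for odd `L ≥ 3`, `a > 0`, `m₀² ≥ 0` there are
`B₀, δ > 0` (for each rate exponent `0 < γ < 1∕2`) such that for EVERY index `i = (e, K, n, m², Msz)` the η-difference operator family obeys
the four (3.42) sup inequalities with King's rate factor:  `e_n(λ, y) ≤ B₀·pref4(1)·e^{−δ|y − y′|_M}·(L^{−γ})^K·|λ|` for `supp λ ⊂ B(y′)`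
(parts P″, Q4a, Q4b at `D = ⌊|y − y′|_M⌋`, rate `L^{−γ′∕2}` with `γ′ = 2γ < 1`). [cite: Balaban1985BackgroundPropagators, Thm 3.1 (3.42) p.397 + Thm 3.14 pp.426–427 (template); King1986, Theorem 3.3 (3.7) p.658, Prop. 3.8 (3.71) p.664, Prop. 3.9 (3.73) p.665] -/
theorem etaRateIneq342_fullProp (L : ℕ) [NeZero L] (hLodd : Odd L) (hL : 2 ≤ L) {a : ℝ} (ha : 0 < a) {m0sq : ℝ} (hm0 : 0 ≤ m0sq)
    {γ : ℝ} (hγpos : 0 < γ) (hγhalf : γ < 1 / 2) :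
    ∃ B₀ δ : ℝ, 0 < B₀ ∧ 0 < δ ∧ ∀ i : EtaLatIdx d m0sq,
      EtaRateIneq342 (etaLatKF d L a m0sq i) B₀ δ γ () := by
  have hγ0 : (0 : ℝ) ≤ 2 * γ := by linarith
  have hγ1 : 2 * γ < 1 := by linarith
  have hL0 : (0 : ℝ) < L := by exact_mod_cast (show 0 < L by omega)
  obtain ⟨C₀, δ₀, hC₀, hδ₀, H₀⟩ := fullPropOp_rate_printed (d := d) L hLodd hL ha hm0 hγ0 hγ1.le
  obtain ⟨C₁, δ₁, hC₁, hδ₁, H₁⟩ := fullPropDOp_rate_printed (d := d) L hLodd hL ha hm0 hγ0 hγ1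
  obtain ⟨C₂, δ₂, hC₂, hδ₂, H₂⟩ := fullPropAdjOp_rate_printed (d := d) L hLodd hL ha hm0 hγ0 hγ1
  obtain ⟨C₃, δ₃, hC₃, hδ₃, H₃⟩ := fullPropLapOp_rate_printed (d := d) L hLodd hL ha hm0 hγ0 hγ1.le
  set δ : ℝ := min (min δ₀ δ₁) (min δ₂ δ₃) with hδdef
  have hδ : 0 < δ := lt_min (lt_min hδ₀ hδ₁) (lt_min hδ₂ hδ₃)
  have hδ0' : δ ≤ δ₀ := (min_le_left _ _).trans (min_le_left _ _)
  have hδ1' : δ ≤ δ₁ := (min_le_left _ _).trans (min_le_right _ _)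
  have hδ2' : δ ≤ δ₂ := (min_le_right _ _).trans (min_le_left _ _)
  have hδ3' : δ ≤ δ₃ := (min_le_right _ _).trans (min_le_right _ _)
  set Csum : ℝ := C₀ + (d + 1 : ℕ) * C₁ + (d + 1 : ℕ) * C₂ + C₃ with hCsum
  have hp1 : 0 ≤ ((d + 1 : ℕ) : ℝ) * C₁ := by positivity
  have hp2 : 0 ≤ ((d + 1 : ℕ) : ℝ) * C₂ := by positivity
  have hCsum0 : 0 < Csum := by rw [hCsum]; linarith
  have hC₀le : C₀ ≤ Csum := by rw [hCsum]; linarith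
  have hC₁le : ((d + 1 : ℕ) : ℝ) * C₁ ≤ Csum := by rw [hCsum]; linarith
  have hC₂le : ((d + 1 : ℕ) : ℝ) * C₂ ≤ Csum := by rw [hCsum]; linarith
  have hC₃le : C₃ ≤ Csum := by rw [hCsum]; linarith
  refine ⟨Csum * Real.exp δ, δ, by positivity, hδ, fun i => ?_⟩
  set θ : ℝ := (L : ℝ) ^ (-(2 * γ / 2)) with hθdef
  have hθ0 : 0 < θ := Real.rpow_pos_of_pos hL0 _
  have hθγ : ((L : ℝ) ^ (-γ)) ^ i.K = θ ^ i.K := by rw [hθdef, show (2 : ℝ) * γ / 2 = γ by ring]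
  intro nn lam y y' hsupp
  set M := EtaLatIdx.cube L i with hMdef
  have hM : ∀ μ, M μ = 2 * L ^ i.e := fun _ => rfl
  set F : ℝ := (etaLatInstance d L m0sq i).gc.supNorm lam with hFdef
  have hF : ∀ z, |lam z| ≤ F := fun z => Finset.le_sup' (fun z => |lam z|) (Finset.mem_univ z)
  have hF0 : 0 ≤ F := (abs_nonneg (lam 0)).trans (hF 0)
  set t : ℝ := tdistT M y y' with htdef
  set D : ℕ := ⌊t⌋₊ with hDdef
  have hDt : (D : ℝ) ≤ t := Nat.floor_le (tdistT_nonneg M y y')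
  -- the support hypothesis in the parts' currency, at any fine point of the block `y`
  have hsuppD : ∀ x' : Tor (fine (L ^ i.n * L ^ i.K) M), blockOf (L ^ i.n * L ^ i.K) M x' = y →
      ∀ z, lam z ≠ 0 → (D : ℝ) ≤ tdistT M (blockOf (L ^ i.K) M (underPtN L i.K i.n M x')) (blockOf (L ^ i.K) M z) := by
    intro x' hx z hz
    rw [blockOf_underPtN, hx, hsupp z hz]
    exact hDt
  have hlen : (etaLatInstance d L m0sq i).gc.len y = 1 := etaLatGeo_len (L : ℝ) i.Msz i.K (L ^ i.K) M hL0.ne' y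
  have hrf : ∀ z : Tor M, rateFactor (etaLatInstance d L m0sq i).gc γ z = θ ^ i.K := fun z => by
    rw [← hθγ]
    exact rateFactor_etaLatGeo (L : ℝ) i.Msz i.K (L ^ i.K) M hL0 γ z
  have hdist : (etaLatInstance d L m0sq i).gc.dist y y' = t := rfl
  have hRHS : Csum * Real.exp δ * B9.pref4 ((etaLatInstance d L m0sq i).gc.len y) nn
        * Real.exp (-(δ * (etaLatInstance d L m0sq i).gc.dist y y'))
        * max (rateFactor (etaLatInstance d L m0sq i).gc γ y) (rateFactor (etaLatInstance d L m0sq i).gc γ y') * F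
      = Csum * Real.exp δ * Real.exp (-(δ * t)) * θ ^ i.K * F := by
    rw [hlen, pref4_one, hrf, hrf, max_self, mul_one, hdist]
  rw [hRHS]
  have hbig : ∀ {C δ' : ℝ}, 0 ≤ C → C ≤ Csum → δ ≤ δ' →
      C * θ ^ i.K * Real.exp (-(δ' * D)) * F ≤ Csum * Real.exp δ * Real.exp (-(δ * t)) * θ ^ i.K * F := by
    intro C δ' hC hCle hδle
    refine (floor_rate_le hC (pow_nonneg hθ0.le _) hF0 hδ.le hδle).trans ?_
    have hq : 0 ≤ Real.exp δ * Real.exp (-(δ * t)) * θ ^ i.K * F := by positivity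
    calc C * Real.exp δ * Real.exp (-(δ * t)) * θ ^ i.K * F = C * (Real.exp δ * Real.exp (-(δ * t)) * θ ^ i.K * F) := by ring
      _ ≤ Csum * (Real.exp δ * Real.exp (-(δ * t)) * θ ^ i.K * F) := mul_le_mul_of_nonneg_right hCle hq
      _ = Csum * Real.exp δ * Real.exp (-(δ * t)) * θ ^ i.K * F := by ring
  have hRHS0 : 0 ≤ Csum * Real.exp δ * Real.exp (-(δ * t)) * θ ^ i.K * F := by positivity
  fin_cases nn
  · -- entry 0: part P″
    show etaLatE0 L a i () lam y ≤ _
    refine Finset.sup'_le _ _ fun x' _ => ?_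
    split_ifs with hx
    · exact (H₀ i.K i.one_le_K i.n i.one_le_n i.e M hM i.msq i.msq_pos i.msq_le lam F hF D x' (hsuppD x' hx)).trans
        (hbig hC₀.le hC₀le hδ0')
    · exact hRHS0
  · -- entry 1: part Q4a, summed over the directions
    show etaLatE1 L a i () lam y ≤ _
    refine Finset.sup'_le _ _ fun x' _ => ?_
    split_ifs with hx
    swap
    · exact hRHS0
    have hμ : ∀ μ : Fin (d + 1), |((L ^ i.n * L ^ i.K : ℕ) : ℝ) *
              ((etaLatA' L a i *ᵥ (fun y' => lam (underPtN L i.K i.n M y'))) (x' + unitVec (fine (L ^ i.n * L ^ i.K) M) μ)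
                - (etaLatA' L a i *ᵥ (fun y' => lam (underPtN L i.K i.n M y'))) x')
          - ((L ^ i.K : ℕ) : ℝ) *
              ((etaLatA L a i *ᵥ lam) (underPtN L i.K i.n M x' + unitVec (fine (L ^ i.K) M) μ)
                - (etaLatA L a i *ᵥ lam) (underPtN L i.K i.n M x'))|
        ≤ C₁ * θ ^ i.K * Real.exp (-(δ₁ * D)) * F :=
      fun μ => H₁ i.K i.one_le_K i.n i.one_le_n i.e M hM i.msq i.msq_pos i.msq_le μ lam F hF D x' (hsuppD x' hx)
    calc _ ≤ ∑ _μ : Fin (d + 1), C₁ * θ ^ i.K * Real.exp (-(δ₁ * D)) * F := Finset.sum_le_sum fun μ _ => hμ μ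
      _ = ((d + 1 : ℕ) : ℝ) * C₁ * θ ^ i.K * Real.exp (-(δ₁ * D)) * F := by
          rw [Finset.sum_const, Finset.card_univ, Fintype.card_fin, nsmul_eq_mul]; ring
      _ ≤ _ := hbig (by positivity) hC₁le hδ1'
  · -- entry 2: part Q4a (transposed gradient, summation by parts), summed over the directions
    show etaLatE2 L a i () lam y ≤ _
    refine Finset.sup'_le _ _ fun x' _ => ?_
    split_ifs with hx
    swap
    · exact hRHS0
    have hμ : ∀ μ : Fin (d + 1),
        |(etaLatA' L a i *ᵥ (fun y' => ((L ^ i.n * L ^ i.K : ℕ) : ℝ) *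
              (lam (underPtN L i.K i.n M (y' - unitVec (fine (L ^ i.n * L ^ i.K) M) μ)) - lam (underPtN L i.K i.n M y')))) x'
          - (etaLatA L a i *ᵥ (fun z => ((L ^ i.K : ℕ) : ℝ) * (lam (z - unitVec (fine (L ^ i.K) M) μ) - lam z)))
              (underPtN L i.K i.n M x')|
        ≤ C₂ * θ ^ i.K * Real.exp (-(δ₂ * D)) * F :=
      fun μ => H₂ i.K i.one_le_K i.n i.one_le_n i.e M hM i.msq i.msq_pos i.msq_le μ lam F hF D x' (hsuppD x' hx)
    calc _ ≤ ∑ _μ : Fin (d + 1), C₂ * θ ^ i.K * Real.exp (-(δ₂ * D)) * F := Finset.sum_le_sum fun μ _ => hμ μ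
      _ = ((d + 1 : ℕ) : ℝ) * C₂ * θ ^ i.K * Real.exp (-(δ₂ * D)) * F := by
          rw [Finset.sum_const, Finset.card_univ, Fintype.card_fin, nsmul_eq_mul]; ring
      _ ≤ _ := hbig (by positivity) hC₂le hδ2'
  · -- entry 3: part Q4b (the equation)
    show etaLatE3 L a i () lam y ≤ _
    refine Finset.sup'_le _ _ fun x' _ => ?_
    split_ifs with hx
    · exact (H₃ i.K i.one_le_K i.n i.one_le_n i.e M hM i.msq i.msq_pos i.msq_le lam F hF D x' (hsuppD x' hx)).trans
        (hbig hC₃.le hC₃le hδ3')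
    · exact hRHS0

/-- ★★★ **NE2⁰'s OPERATOR LAYER HOLDS FOR KING'S ∕ BAŁABAN'S FULL `A = 0` FLUCTUATION PROPAGATOR WITH η-LATTICE TEST FUNCTIONS**: for odd
`L ≥ 3`, `a > 0`, `m₀² ≥ 0`, the hypothesis shape `T4EtaRate.NE2ZeroOperator` (the four (3.42) sup entries of the η-difference family with King's
rate factor, uniform constants) is a THEOREM for the family `etaLatInstance ∕ etaLatKF` — constants `(M₅, δ₀, B₀, γ) = (1, δ, B₀, 1∕4)`, uniform in the
cube, the number of levels `K`, the scale shift `n`, the mass `0 < m² ≤ m₀²` and the cube-size parameter.  HONEST: a decided HYPOTHESIS SHAPE of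
the cell in King's `A = 0` model (no large fields, single scale), not a printed proposition; NOT NE2⁺ for Bałaban's live `G_k(U)`; not a discharge.
[cite: Balaban1985BackgroundPropagators, Thm 3.1 (3.42) p.397, Thm 3.14 pp.426–427 (template); King1986, Theorem 3.3 (3.7) p.658, Props. 3.8–3.9 (3.71)–(3.73) pp.664–665 (A = 0 model)] -/
theorem ne2ZeroOperator_fullProp (d L : ℕ) [NeZero L] (hLodd : Odd L) (hL : 2 ≤ L) {a : ℝ} (ha : 0 < a) {m0sq : ℝ} (hm0 : 0 ≤ m0sq) :
    NE2ZeroOperator (etaLatInstance d L m0sq) (etaLatKF d L a m0sq) := by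
  obtain ⟨B₀, δ, hB₀, hδ, H⟩ := etaRateIneq342_fullProp (d := d) L hLodd hL ha hm0 (γ := 1 / 4) (by norm_num) (by norm_num)
  exact ⟨1, δ, B₀, 1 / 4, one_pos, hδ, hB₀, by norm_num, fun i _ => H i⟩

/-- **… and NE2⁺'s operator layer on the one-point background sort** (every `c35`): the model decides the layer up to EXACTLY the background
quantifier `∀ U, Reg335 c35 α₀ U → …` over a LIVE background sort (g0 `ne2PlusOperator_iff_ne2ZeroOperator`) — what Bałaban's `G_k(U)` adds.
[cite: Balaban1985BackgroundPropagators, (3.35) p.396, Thm 3.1 (3.42) p.397, Thm 3.4 p.400] -/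
theorem ne2PlusOperator_fullProp (d L : ℕ) [NeZero L] (hLodd : Odd L) (hL : 2 ≤ L) {a : ℝ} (ha : 0 < a) {m0sq : ℝ} (hm0 : 0 ≤ m0sq)
    (c35 : ℝ) : NE2PlusOperator c35 (etaLatInstance d L m0sq) (etaLatKF d L a m0sq) :=
  (ne2PlusOperator_iff_ne2ZeroOperator (pi := etaLatInstance d L m0sq) c35 (fun _ => instSubsingletonPUnit)
    (fun _ _ _ => trivial)).mpr (ne2ZeroOperator_fullProp d L hLodd hL ha hm0)

end Summit.QuantumFields.YangMills.BalabanUVNodes.N15KingModelRung.Curved
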